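import Mathlib
import Literature.Combinatorics.Additive.LinearVosperProofs

/-!
# Two-dimensional critical pairs in a field extension (helpers for `TwoByTwoHostingEight`)

Route FieldSumsetRank, item stmt-MatrixMultiplication-8741 (`TwoByTwoHostingEight`).
Elementary facts about dilated geometric progressions `g · ⟨1, a, …, a^{n-1}⟩` in a field
`L ⊇ ℂ` (products, dimensions), and the structure of pairs of planes `S, T` with
`dim(ST) ≤ 3`: such a pair is a pair of dilates of a common progression `⟨1, b⟩` (the `2 × 2`
case of the linear Vosper theorem, proved directly). Progressions are written
`Submodule.span ℂ (Set.range fun i : Fin n => a ^ (i : ℕ))` as in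
`Literature.Combinatorics.Additive.LinearVosper`, dilates as `M.map (LinearMap.mulLeft ℂ g)`.
-/

set_option linter.dupNamespace false

noncomputable section

open Module

namespace Summit.MatrixMultiplication.MatrixMultiplication.Theorems

namespace TwoByTwoHosting

open Literature.Combinatorics.Additive.BachocSerraZemor

section Pairs

variable {L : Type*} [Field L] [Algebra ℂ L]

/-- `g · ⟨1, a, …⟩ = ⟨g, ga, …⟩`. -/
theorem dil_prog (g a : L) (n : ℕ) :
    (Submodule.span ℂ (Set.range fun i : Fin n => a ^ (i : ℕ))).map (LinearMap.mulLeft ℂ g) =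
      Submodule.span ℂ (Set.range fun i : Fin n => g * a ^ (i : ℕ)) := by
  rw [Submodule.map_span, ← Set.range_comp]
  rfl

/-- Products of progressions: `⟨1,…,a^m⟩ · ⟨1,…,a^n⟩ = ⟨1,…,a^{m+n}⟩`. -/
theorem prog_mul_prog (a : L) (m n : ℕ) :
    Submodule.span ℂ (Set.range fun i : Fin (m + 1) => a ^ (i : ℕ)) *
        Submodule.span ℂ (Set.range fun i : Fin (n + 1) => a ^ (i : ℕ)) =
      Submodule.span ℂ (Set.range fun i : Fin (m + n + 1) => a ^ (i : ℕ)) := by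
  apply le_antisymm
  · rw [Submodule.mul_le]
    intro x hx y hy
    refine Submodule.span_induction
      (p := fun x _ =>
        x * y ∈ Submodule.span ℂ (Set.range fun i : Fin (m + n + 1) => a ^ (i : ℕ)))
      ?_ ?_ ?_ ?_ hx
    · rintro _ ⟨i, rfl⟩
      refine Submodule.span_induction
        (p := fun y _ =>
          a ^ (i : ℕ) * y ∈
            Submodule.span ℂ (Set.range fun i : Fin (m + n + 1) => a ^ (i : ℕ)))
        ?_ ?_ ?_ ?_ hy
      · rintro _ ⟨j, rfl⟩
        rw [← pow_add]
        exact Submodule.subset_span ⟨⟨(i : ℕ) + j, by omega⟩, rfl⟩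
      · simp
      · intro u v _ _ hu hv
        rw [mul_add]
        exact add_mem hu hv
      · intro c u _ hu
        rw [mul_smul_comm]
        exact Submodule.smul_mem _ c hu
    · simp
    · intro u v _ _ hu hv
      rw [add_mul]
      exact add_mem hu hv
    · intro c u _ hu
      rw [smul_mul_assoc]
      exact Submodule.smul_mem _ c hu
  · rw [Submodule.span_le]
    rintro _ ⟨k, rfl⟩
    have hk : (k : ℕ) = min (k : ℕ) m + ((k : ℕ) - min (k : ℕ) m) := by omega
    change a ^ (k : ℕ) ∈ _
    rw [hk, pow_add]
    exact Submodule.mul_mem_mul (Submodule.subset_span ⟨⟨min (k : ℕ) m, by omega⟩, rfl⟩)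
      (Submodule.subset_span ⟨⟨(k : ℕ) - min (k : ℕ) m, by omega⟩, rfl⟩)

/-- Products of dilates: `(f M)(g N) = (fg)(MN)`. -/
theorem dil_mul_dil (f g : L) (M N : Submodule ℂ L) :
    M.map (LinearMap.mulLeft ℂ f) * N.map (LinearMap.mulLeft ℂ g) =
      (M * N).map (LinearMap.mulLeft ℂ (f * g)) := by
  rw [map_mulLeft_mul, Submodule.mul_comm M (N.map _), map_mulLeft_mul, Submodule.mul_comm N M,
    ← Submodule.map_comp, ← LinearMap.mulLeft_mul, mul_comm f g]

/-- `f (g M) = (fg) M`. -/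
theorem dil_dil (f g : L) (M : Submodule ℂ L) :
    (M.map (LinearMap.mulLeft ℂ g)).map (LinearMap.mulLeft ℂ f) =
      M.map (LinearMap.mulLeft ℂ (f * g)) := by
  rw [← Submodule.map_comp, ← LinearMap.mulLeft_mul]

/-- `1 · M = M`. -/
theorem dil_one (M : Submodule ℂ L) : M.map (LinearMap.mulLeft ℂ (1 : L)) = M := by
  rw [LinearMap.mulLeft_one, Submodule.map_id]

/-- A progression of a non-scalar ratio has the expected dimension. -/
theorem finrank_prog {a : L} (ha : ∀ c : ℂ, algebraMap ℂ L c ≠ a) (n : ℕ) :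
    finrank ℂ (Submodule.span ℂ (Set.range fun i : Fin n => a ^ (i : ℕ))) = n := by
  have h := linearIndependent_mul_pow (transcendental_of_forall_ne ha) (one_ne_zero (α := L)) n
  simp only [one_mul] at h
  rw [finrank_span_eq_card h, Fintype.card_fin]

/-- Dilating by a non-zero element preserves dimension. -/
theorem finrank_dil {g : L} (hg : g ≠ 0) (M : Submodule ℂ L) :
    finrank ℂ (M.map (LinearMap.mulLeft ℂ g)) = finrank ℂ M :=
  finrank_map_mulLeft hg M

/-- Products of finite-dimensional subspaces are finite-dimensional. -/
theorem finiteDimensional_mul (M N : Submodule ℂ L) [FiniteDimensional ℂ M]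
    [FiniteDimensional ℂ N] : FiniteDimensional ℂ ↥(M * N) :=
  Module.Finite.iff_fg.mpr ((Module.Finite.iff_fg.mp ‹_›).mul (Module.Finite.iff_fg.mp ‹_›))

/-- **Planes with a three-dimensional product** (the `2 × 2` case of the linear Vosper theorem):
if `dim S = dim T = 2` and `dim(ST) ≤ 3` then `S = f⟨1, b⟩`, `T = g⟨1, b⟩` for some
`f, g ≠ 0` and a non-scalar `b`. Indeed for a basis `s₁, s₂` of `S` the planes
`s₁T, s₂T ⊆ ST` meet: `s₁t₁ = s₂t₂ ≠ 0`, and `b = s₂/s₁ = t₁/t₂` works. -/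
theorem pair_structure (S T : Submodule ℂ L) [FiniteDimensional ℂ S] [FiniteDimensional ℂ T]
    (hS : finrank ℂ S = 2) (hT : finrank ℂ T = 2) [FiniteDimensional ℂ ↥(S * T)]
    (hST : finrank ℂ ↥(S * T) ≤ 3) :
    ∃ f g b : L, f ≠ 0 ∧ g ≠ 0 ∧ (∀ c : ℂ, algebraMap ℂ L c ≠ b) ∧
      S = (Submodule.span ℂ (Set.range fun i : Fin 2 => b ^ (i : ℕ))).map
        (LinearMap.mulLeft ℂ f) ∧
      T = (Submodule.span ℂ (Set.range fun i : Fin 2 => b ^ (i : ℕ))).map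
        (LinearMap.mulLeft ℂ g) := by
  have hSne : S ≠ ⊥ := by
    rw [Ne, ← Submodule.finrank_eq_zero, hS]
    omega
  obtain ⟨s₁, hs₁S, hs₁⟩ := Submodule.exists_mem_ne_zero_of_ne_bot hSne
  have hlt : (ℂ ∙ s₁) < S := by
    refine lt_of_le_of_ne ((Submodule.span_singleton_le_iff_mem s₁ S).mpr hs₁S)
      fun h => ?_
    have h1 := finrank_span_singleton (K := ℂ) hs₁
    rw [h, hS] at h1
    omega
  obtain ⟨s₂, hs₂S, hs₂⟩ := SetLike.exists_of_lt hlt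
  have hs₂0 : s₂ ≠ 0 := fun h => hs₂ (h ▸ Submodule.zero_mem _)
  -- the planes `s₁ T`, `s₂ T` inside `ST`
  have hle : ∀ s ∈ S, T.map (LinearMap.mulLeft ℂ s) ≤ S * T := fun s hs => by
    rw [map_mulLeft_eq_span_singleton_mul]
    exact mul_le_mul_left ((Submodule.span_singleton_le_iff_mem s S).mpr hs) T
  have hdim := Submodule.finrank_sup_add_finrank_inf_eq (T.map (LinearMap.mulLeft ℂ s₁))
    (T.map (LinearMap.mulLeft ℂ s₂))
  rw [finrank_dil hs₁, finrank_dil hs₂0, hT] at hdim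
  haveI : FiniteDimensional ℂ
      ↥(T.map (LinearMap.mulLeft ℂ s₁) ⊔ T.map (LinearMap.mulLeft ℂ s₂)) :=
    Submodule.finiteDimensional_of_le (sup_le (hle s₁ hs₁S) (hle s₂ hs₂S))
  have hsup :
      finrank ℂ ↥(T.map (LinearMap.mulLeft ℂ s₁) ⊔ T.map (LinearMap.mulLeft ℂ s₂)) ≤
        3 :=
    (Submodule.finrank_mono (sup_le (hle s₁ hs₁S) (hle s₂ hs₂S))).trans hST
  have hinf :
      T.map (LinearMap.mulLeft ℂ s₁) ⊓ T.map (LinearMap.mulLeft ℂ s₂) ≠ ⊥ := by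
    intro h
    rw [h, finrank_bot] at hdim
    omega
  obtain ⟨x, hx, hx0⟩ := Submodule.exists_mem_ne_zero_of_ne_bot hinf
  obtain ⟨t₁, ht₁T, ht₁⟩ := Submodule.mem_map.mp (Submodule.mem_inf.mp hx).1
  obtain ⟨t₂, ht₂T, ht₂⟩ := Submodule.mem_map.mp (Submodule.mem_inf.mp hx).2
  rw [LinearMap.mulLeft_apply] at ht₁ ht₂
  have ht₂0 : t₂ ≠ 0 := by
    rintro rfl
    rw [mul_zero] at ht₂
    exact hx0 ht₂.symm
  -- the common ratio
  set b : L := s₂ / s₁ with hb_def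
  have hs₁b : s₁ * b = s₂ := by rw [hb_def, mul_div_cancel₀ s₂ hs₁]
  have ht₂b : t₂ * b = t₁ := by
    rw [hb_def, mul_div_assoc', div_eq_iff hs₁, mul_comm t₂ s₂, ht₂, ← ht₁, mul_comm]
  have hb : ∀ c : ℂ, algebraMap ℂ L c ≠ b := by
    intro c hc
    apply hs₂
    rw [Submodule.mem_span_singleton]
    exact ⟨c, by rw [Algebra.smul_def, hc, ← hs₁b, mul_comm]⟩
  have hbtr : Transcendental ℂ b := transcendental_of_forall_ne hb
  refine ⟨s₁, t₂, b, hs₁, ht₂0, hb, ?_, ?_⟩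
  · rw [dil_prog]
    refine (span_eq_of_forall_mul_pow_mem hbtr hs₁ S hS fun i hi => ?_).symm
    interval_cases i
    · simpa using hs₁S
    · simpa [hs₁b] using hs₂S
  · rw [dil_prog]
    refine (span_eq_of_forall_mul_pow_mem hbtr ht₂0 T hT fun i hi => ?_).symm
    interval_cases i
    · simpa using ht₂T
    · simpa [ht₂b] using ht₁T

end Pairs

end TwoByTwoHosting

end Summit.MatrixMultiplication.MatrixMultiplication.Theorems
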